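import Mathlib
import Summits.NavierStokesRegularity.NavierStokesRegularity.Theorems.TaoLadderRungTwoBreakBlowupRigidityOneCriticalCeiling
import HarnessLib

/-!
# ONE quiet shell regularises a viscous cascade flow; hence EVERY shell of every viscous companion of a robust blow-up
  is (S₁)-loud — the lower-pinning clause of `WakeRatchet.MinimalViscousBlowup` ⟨22743⟩ at every small viscosity, and
  the every-shell form of the survival half of `stub_eternalFromBlowup` (K2(1) `TaoLadderRungTwoBreak.BlowupRigidityOne`,
  stmt-NavierStokesRegularity-20206) for the viscous blow-ups

MODEL lattice ODEs only (Tao 2016 §4: the NS-scaled viscous lattice before Theorem 4.2, (4.3), Lemma 4.1 (4.5)); nothing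
here is a statement about the Navier–Stokes equations; NO item is closed (`--supports stmt-NavierStokesRegularity-20206`).
Route-independent, general `m`, DEF-FREE. Third module of the dissipation-threshold series (`…SubcriticalCeiling`,
`…CriticalCeiling`): the back-reaction terms TELESCOPE inside the energy of the block of shells above a given one, so a
bound on ONE shell bounds everything above it (no hypothesis on the shell two above, unlike `norm_shellVec_le_of_dampedShell`).
* `tail_norm_le_of_shellBound` — TAIL QUASI-STATIC BOUND: `‖x_n(t)‖ ≤ s` on `[0,T)` for one shell `n ≥ 0` of a `ν̂`-viscous
  flow from a one-shell datum ((4.5)-regular before `T`) ⇒ `‖x_j(t)‖ ≤ Λ^n C_A s²/(ν̂(1+ε₀)^{2(n+1)})` for every `j > n`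
  (`C_A = shiftConst α (0,0,1)`; block energy `Σ_{n<k≤K'}‖x_k‖²`: derivative `f_n - f_{K'} - dissipation`, dissipation
  `≥ 2ν̂(1+ε₀)^{2(n+1)}·block`, `f_n ≤ 2Λ^nC_As²√block`, top flux `f_{K'} → 0` by (4.5); barrier comparison, `K' → ∞`);
* `weight45_bounded_of_oneQuietShell` — ONE shell `n ≥ 0` with `(1+ε₀)^n ‖x_n(t)‖² ≤ B²` on `[0,T)`, `B ≤ B₁ =
  ν̂/(2(C_A+1)(1+ε₀)^9)` ⇒ every shell `j ≥ n` is quiet at level `B` (induction on the tail bound) ⇒ (4.5)-regular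
  (`weight45_bounded_of_smallCriticalCeiling`);
* `everyShellLoud_of_noGlobalCascade` — **ROBUST BLOW-UP ⇒ for every `0 < ν̂ ≤ κ/√2`, EVERY shell `n ≥ 0` of the maximal
  `ν̂`-viscous flow reaches `(1+ε₀)^n ‖x_n(t)‖² > B₁²` at some `t < T`** — clause (iv) («`c ≤ (1+ε₀)^n‖X_n(t)‖²` at some
  `t < T` for EVERY `n ≥ 0`») of `WakeRatchet.MinimalViscousBlowup` (stmt-22743) for every small viscosity with `c = B₁(ν̂)²`,
  not only at a selected threshold; clauses (i) type I, (ii) action, (iii) upper pinning are NOT addressed.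
HONEST LABEL: no stub, crux or summit is proved; the level `B₁(ν̂)² → 0` with `ν̂`; rung 0.
-/

noncomputable section

-- the summit and its single sub-problem share the name (CONVENTIONS §1)
set_option linter.dupNamespace false

open Set Filter Topology
open scoped RealInnerProductSpace

namespace Summit.NavierStokesRegularity.NavierStokesRegularity.Theorems

namespace BlowupRigidityOne

open Literature.Analysis.FluidPDE Literature.Analysis.FluidPDE.TaoCascade

variable {m : ℕ}

/-- **TAIL QUASI-STATIC BOUND.** `ε₀ > 0`, `ν̂ > 0`, `α` cancelling; `X` a `ν̂`-viscous flow on `[0,T)` from the one-shell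
datum `X₀` at shell `0`, (4.5)-regular before `T`. If one shell `n ≥ 0` obeys `‖x_n(t)‖ ≤ s` on `[0,T)`, then every shell
`j > n` obeys `‖x_j(t)‖ ≤ Λ^n C_A s² / (ν̂ (1+ε₀)^{2(n+1)})` on `[0,T)`, `C_A = shiftConst α (0,0,1)`.
[cite: Tao2016AveragedNS, §4 (4.3), Lemma 4.1 (4.5) and the viscous equation before Thm. 4.2] -/
theorem tail_norm_le_of_shellBound {ε₀ visc T s : ℝ} (hε : 0 < ε₀) (hvisc : 0 < visc)
    {α : Fin m → Fin m → Fin m → ℤ × ℤ × ℤ → ℝ} (hc : IsCancellingCoeff α)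
    {X : Fin m → ℤ → ℝ → ℝ} {X₀ : Fin m → ℝ}
    (hC1 : ∀ i n, ContDiffOn ℝ 1 (X i n) (Set.Ico 0 T))
    (hinit : ∀ i n, X i n 0 = if n = 0 then X₀ i else 0)
    (hmot : ∀ i n t, 0 ≤ t → t < T → derivWithin (X i n) (Set.Ici 0) t =
      quadTerm ε₀ α X i n t - visc * (1 + ε₀) ^ ((2 : ℝ) * n) * X i n t)
    (hreg : ∀ T' : ℝ, 0 < T' → T' < T → ∃ M : ℝ, ∀ t : ℝ, 0 ≤ t → t ≤ T' →
      ∀ (i : Fin m) (n : ℤ), (1 + (1 + ε₀) ^ ((10 : ℝ) * n)) * |X i n t| ≤ M)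
    {n : ℕ} (hs : ∀ t : ℝ, 0 ≤ t → t < T → ‖shellVec X (n : ℤ) t‖ ≤ s) :
    ∀ j : ℕ, n < j → ∀ t : ℝ, 0 ≤ t → t < T →
      ‖shellVec X (j : ℤ) t‖ ≤ bigLam ε₀ ^ n * shiftConst α (0, 0, 1) * s ^ 2 / (visc * (1 + ε₀) ^ (2 * (n + 1))) := by
  intro j hj t ht0 htT
  have hl0 : (0 : ℝ) < 1 + ε₀ := by linarith
  have hl1 : (1 : ℝ) < 1 + ε₀ := by linarith
  have hL : 0 < bigLam ε₀ := bigLam_pos (by linarith)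
  have hS := table_sTable α hc
  have hC : 0 ≤ shiftConst α (0, 0, 1) := shiftConst_nonneg α _
  have ht : t ∈ Ico (0 : ℝ) T := ⟨ht0, htT⟩
  have hder : ∀ i k, ∀ τ ∈ Ico (0 : ℝ) T, HasDerivWithinAt (X i k)
      (quadTerm ε₀ α X i k τ - visc * (1 + ε₀) ^ ((2 : ℝ) * k) * X i k τ) (Ici 0) τ := by
    intro i k τ hτ
    have hd : DifferentiableWithinAt ℝ (X i k) (Ico 0 T) τ := ((hC1 i k).differentiableOn one_ne_zero) τ hτ
    have hd' : DifferentiableWithinAt ℝ (X i k) (Ici 0) τ := hd.mono_of_mem_nhdsWithin (by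
      rw [mem_nhdsWithin]; exact ⟨Iio T, isOpen_Iio, hτ.2, fun x hx => ⟨hx.2, hx.1⟩⟩)
    rw [← hmot i k τ hτ.1 hτ.2]
    exact hd'.hasDerivWithinAt
  obtain ⟨M₀, hM₀⟩ : ∃ M₀ : ℝ, ∀ τ : ℝ, 0 ≤ τ → τ ≤ t → ∀ (i : Fin m) (k : ℤ),
      (1 + (1 + ε₀) ^ ((10 : ℝ) * k)) * |X i k τ| ≤ M₀ := by
    rcases le_or_gt t 0 with h0 | h0
    · exact (hreg (T / 2) (by linarith) (by linarith)).imp fun M hM τ hτ0 hτt i k => hM τ hτ0 (by linarith) i k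
    · exact hreg t h0 htT
  set M : ℝ := max M₀ 0 with hMdef
  have hM : ∀ τ ∈ Icc (0 : ℝ) t, ∀ (i : Fin m) (k : ℤ), (1 + (1 + ε₀) ^ ((10 : ℝ) * k)) * |X i k τ| ≤ M :=
    fun τ hτ i k => (hM₀ τ hτ.1 hτ.2 i k).trans (le_max_left _ _)
  have hM0 : 0 ≤ M := le_max_right _ _
  set f : ℤ → ℝ → ℝ := fun k τ => 2 * bigLam ε₀ ^ k * ⟪shellVec X (k + 1) τ, tableA α (shellVec X k τ)⟫ with hfdef
  set S : ℕ → ℝ → ℝ := fun K' τ => ∑ k ∈ Finset.range K', ‖shellVec X ((n + 1 + k : ℕ) : ℤ) τ‖ ^ 2 with hSdef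
  set d : ℕ → ℝ → ℝ := fun k τ =>
    2 * (visc * (1 + ε₀) ^ ((2 : ℝ) * (((n + 1 + k : ℕ) : ℤ) : ℝ))) * ‖shellVec X ((n + 1 + k : ℕ) : ℤ) τ‖ ^ 2
    with hddef
  set D : ℝ := 2 * (visc * (1 + ε₀) ^ (2 * (n + 1))) with hDdef
  have hD : 0 < D := by positivity
  have hPk : ∀ k : ℕ, (1 + ε₀) ^ ((2 : ℝ) * (((n + 1 + k : ℕ) : ℤ) : ℝ)) = ((1 + ε₀) ^ 2) ^ (n + 1 + k) := fun k => by
    rw [Int.cast_natCast, Real.rpow_mul hl0.le, Real.rpow_two, Real.rpow_natCast]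
  have hdS : ∀ K' τ, D * S K' τ ≤ ∑ k ∈ Finset.range K', d k τ := by
    intro K' τ
    rw [hSdef, Finset.mul_sum]
    refine Finset.sum_le_sum fun k _ => ?_
    simp only [hddef, hDdef]
    rw [hPk k, ← pow_mul]
    have hle : (1 + ε₀) ^ (2 * (n + 1)) ≤ (1 + ε₀) ^ (2 * (n + 1 + k)) := pow_le_pow_right₀ hl1.le (by omega)
    have h0 : 0 ≤ ‖shellVec X ((n + 1 + k : ℕ) : ℤ) τ‖ ^ 2 := by positivity
    nlinarith [mul_le_mul_of_nonneg_right hle h0, hvisc]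
  have hSder : ∀ K' : ℕ, ∀ τ ∈ Icc (0 : ℝ) t,
      HasDerivWithinAt (S K') (f n τ - f ((n + K' : ℕ) : ℤ) τ - ∑ k ∈ Finset.range K', d k τ) (Ici 0) τ := by
    intro K' τ hτ
    have hτT : τ ∈ Ico (0 : ℝ) T := ⟨hτ.1, lt_of_le_of_lt hτ.2 ht.2⟩
    have hterm : ∀ k ∈ Finset.range K', HasDerivWithinAt (fun σ => ‖shellVec X ((n + 1 + k : ℕ) : ℤ) σ‖ ^ 2)
        ((f (((n + 1 + k : ℕ) : ℤ) - 1) τ - f ((n + 1 + k : ℕ) : ℤ) τ) - d k τ) (Ici 0) τ := by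
      intro k _
      have h := viscousShellEnergy_hasDerivWithinAt hε hc (ν := visc) (k := ((n + 1 + k : ℕ) : ℤ))
        (fun i => hder i _ τ hτT)
      simp only [hfdef, hddef, sub_add_cancel]
      exact h
    have hsum := HasDerivWithinAt.sum hterm
    have htel : ∑ k ∈ Finset.range K', ((f (((n + 1 + k : ℕ) : ℤ) - 1) τ - f ((n + 1 + k : ℕ) : ℤ) τ) - d k τ) =
        f n τ - f ((n + K' : ℕ) : ℤ) τ - ∑ k ∈ Finset.range K', d k τ := by
      rw [Finset.sum_sub_distrib]
      have h := Finset.sum_range_sub' (fun k : ℕ => f ((n + k : ℕ) : ℤ) τ) K'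
      have e1 : ∀ k : ℕ, f (((n + 1 + k : ℕ) : ℤ) - 1) τ = f ((n + k : ℕ) : ℤ) τ := fun k => by
        congr 1; push_cast; ring
      have e2 : ∀ k : ℕ, f ((n + 1 + k : ℕ) : ℤ) τ = f ((n + (k + 1) : ℕ) : ℤ) τ := fun k => by
        congr 1; push_cast; ring
      simp only [e1, e2]
      rw [h]
      simp
    rw [htel, Finset.sum_fn] at hsum
    exact hsum
  have hW1 : ∀ k : ℤ, (1 : ℝ) ≤ 1 + (1 + ε₀) ^ ((10 : ℝ) * k) := fun k => by linarith [Real.rpow_nonneg hl0.le ((10 : ℝ) * k)]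
  have hcomp : ∀ τ ∈ Icc (0 : ℝ) t, ∀ (i : Fin m) (k : ℤ), |X i k τ| ≤ M / (1 + (1 + ε₀) ^ ((10 : ℝ) * k)) :=
    fun τ hτ i k => by
      rw [le_div_iff₀ (lt_of_lt_of_le one_pos (hW1 k)), mul_comm]; exact hM τ hτ i k
  have hxle : ∀ τ ∈ Icc (0 : ℝ) t, ∀ k : ℤ, ‖shellVec X k τ‖ ≤ Real.sqrt m * (M / (1 + (1 + ε₀) ^ ((10 : ℝ) * k))) :=
    fun τ hτ k => DSSOneShift.norm_shellVec_le_sqrt_mul (div_nonneg hM0 (lt_of_lt_of_le one_pos (hW1 k)).le)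
      (fun i => hcomp τ hτ i k)
  have hxle' : ∀ τ ∈ Icc (0 : ℝ) t, ∀ k : ℤ, ‖shellVec X k τ‖ ≤ Real.sqrt m * M := fun τ hτ k =>
    (hxle τ hτ k).trans (mul_le_mul_of_nonneg_left (div_le_self hM0 (hW1 k)) (Real.sqrt_nonneg _))
  set q : ℝ := bigLam ε₀ / (1 + ε₀) ^ (10 : ℝ) with hqdef
  have hP10 : 0 < (1 + ε₀) ^ (10 : ℝ) := Real.rpow_pos_of_pos hl0 _
  have hq0 : 0 ≤ q := div_nonneg hL.le hP10.le
  have hq1 : q < 1 := by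
    rw [hqdef, div_lt_one hP10]; unfold bigLam; exact Real.rpow_lt_rpow_of_exponent_lt hl1 (by norm_num)
  set Cf : ℝ := 2 * fluxConst α * (Real.sqrt m * M) ^ 3 with hCfdef
  have hCf0 : 0 ≤ Cf := by have := fluxConst_nonneg α; positivity
  have hfbound : ∀ K : ℕ, ∀ τ ∈ Icc (0 : ℝ) t, |f K τ| ≤ Cf * q ^ K := by
    intro K τ hτ
    have hA := hS.normA (shellVec X K τ)
    have h1 : |⟪shellVec X ((K : ℤ) + 1) τ, tableA α (shellVec X K τ)⟫| ≤
        (Real.sqrt m * M) * (fluxConst α * (‖shellVec X (K : ℤ) τ‖ * ‖shellVec X (K : ℤ) τ‖)) := by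
      refine (abs_real_inner_le_norm _ _).trans ?_
      rw [← sq]
      exact mul_le_mul (hxle' τ hτ _) hA (norm_nonneg _) (by positivity)
    have h2 : ‖shellVec X (K : ℤ) τ‖ * ‖shellVec X (K : ℤ) τ‖ ≤
        (Real.sqrt m * M) * (Real.sqrt m * (M / (1 + (1 + ε₀) ^ ((10 : ℝ) * ((K : ℤ) : ℝ))))) :=
      mul_le_mul (hxle' τ hτ _) (hxle τ hτ _) (norm_nonneg _) (by positivity)
    have hW : ((1 + ε₀) ^ (10 : ℝ)) ^ K ≤ 1 + (1 + ε₀) ^ ((10 : ℝ) * ((K : ℤ) : ℝ)) := by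
      have : ((1 + ε₀) ^ (10 : ℝ)) ^ K = (1 + ε₀) ^ ((10 : ℝ) * ((K : ℤ) : ℝ)) := by
        rw [← Real.rpow_natCast, ← Real.rpow_mul hl0.le]; push_cast; ring_nf
      linarith
    have hW0 : 0 < ((1 + ε₀) ^ (10 : ℝ)) ^ K := pow_pos hP10 _
    have h3 : M / (1 + (1 + ε₀) ^ ((10 : ℝ) * ((K : ℤ) : ℝ))) ≤ M / ((1 + ε₀) ^ (10 : ℝ)) ^ K :=
      div_le_div_of_nonneg_left hM0 hW0 hW
    have hΛK : bigLam ε₀ ^ ((K : ℤ)) = bigLam ε₀ ^ K := zpow_natCast _ _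
    simp only [hfdef]
    rw [abs_mul, abs_mul, abs_two, hΛK, abs_of_pos (pow_pos hL _)]
    have hsm : 0 ≤ Real.sqrt m := Real.sqrt_nonneg _
    calc 2 * bigLam ε₀ ^ K * |⟪shellVec X ((K : ℤ) + 1) τ, tableA α (shellVec X (K : ℤ) τ)⟫|
        ≤ 2 * bigLam ε₀ ^ K * ((Real.sqrt m * M) * (fluxConst α *
            ((Real.sqrt m * M) * (Real.sqrt m * (M / ((1 + ε₀) ^ (10 : ℝ)) ^ K))))) := by
          refine mul_le_mul_of_nonneg_left (h1.trans ?_) (by positivity)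
          refine mul_le_mul_of_nonneg_left (mul_le_mul_of_nonneg_left (h2.trans ?_)
            (fluxConst_nonneg α)) (by positivity)
          exact mul_le_mul_of_nonneg_left (mul_le_mul_of_nonneg_left h3 hsm) (by positivity)
      _ = Cf * (bigLam ε₀ ^ K / ((1 + ε₀) ^ (10 : ℝ)) ^ K) := by
          simp only [hCfdef]; field_simp
      _ = Cf * q ^ K := by rw [hqdef, div_pow]
  set a : ℝ := bigLam ε₀ ^ n * shiftConst α (0, 0, 1) * s ^ 2 with hadef
  have ha0 : 0 ≤ a := by positivity
  have hfin : ∀ K' : ℕ, 1 ≤ K' → ∀ τ ∈ Icc (0 : ℝ) t, f n τ ≤ 2 * a * Real.sqrt (S K' τ) := by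
    intro K' hK' τ hτ
    have hτT : 0 ≤ τ ∧ τ < T := ⟨hτ.1, lt_of_le_of_lt hτ.2 htT⟩
    have hx1 : ‖shellVec X ((n : ℤ) + 1) τ‖ ≤ Real.sqrt (S K' τ) := by
      have hmem : 0 ∈ Finset.range K' := Finset.mem_range.2 hK'
      have h1 : ‖shellVec X ((n + 1 + 0 : ℕ) : ℤ) τ‖ ^ 2 ≤ S K' τ :=
        Finset.single_le_sum (f := fun k => ‖shellVec X ((n + 1 + k : ℕ) : ℤ) τ‖ ^ 2)
          (fun _ _ => by positivity) hmem
      have e : ((n + 1 + 0 : ℕ) : ℤ) = (n : ℤ) + 1 := by push_cast; ring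
      rw [e] at h1
      exact Real.le_sqrt_of_sq_le h1
    have hA : ‖tableA α (shellVec X (n : ℤ) τ)‖ ≤ shiftConst α (0, 0, 1) * s ^ 2 :=
      (norm_tableA_le α _).trans (mul_le_mul_of_nonneg_left
        (pow_le_pow_left₀ (norm_nonneg _) (hs τ hτT.1 hτT.2) 2) hC)
    have hi := real_inner_le_norm (shellVec X ((n : ℤ) + 1) τ) (tableA α (shellVec X (n : ℤ) τ))
    have h2 : ⟪shellVec X ((n : ℤ) + 1) τ, tableA α (shellVec X (n : ℤ) τ)⟫ ≤
        Real.sqrt (S K' τ) * (shiftConst α (0, 0, 1) * s ^ 2) :=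
      hi.trans (mul_le_mul hx1 hA (norm_nonneg _) (Real.sqrt_nonneg _))
    simp only [hfdef, hadef, zpow_natCast]
    nlinarith [h2, pow_pos hL n]
  have hS0 : ∀ K' : ℕ, S K' 0 = 0 := by
    intro K'
    simp only [hSdef]
    refine Finset.sum_eq_zero fun k _ => ?_
    have hk0 : ¬ ((n : ℤ) + 1 + (k : ℤ) = 0) := by omega
    have : shellVec X ((n + 1 + k : ℕ) : ℤ) 0 = 0 := by ext i; simp [shellVec, hinit, hk0]
    rw [this, norm_zero, zero_pow two_ne_zero]
  have hmain : ∀ η' : ℝ, 0 < η' → ‖shellVec X (j : ℤ) t‖ ≤ 2 * a / D + η' := by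
    intro η' hη'
    set L : ℝ := 2 * a / D + η' with hLdef
    have hL0 : 0 < L := by positivity
    obtain ⟨N, hN⟩ := exists_pow_lt_of_lt_one (show 0 < L * D * η' / (2 * (Cf + 1)) by positivity) hq1
    set K' : ℕ := max (j - n) N with hK'def
    have hK'1 : 1 ≤ K' := le_trans (by omega) (le_max_left _ _)
    have hflux : Cf * q ^ (n + K') < L * D * η' / 2 := by
      have hNK : N ≤ n + K' := le_trans (le_max_right (j - n) N) (Nat.le_add_left K' n)
      have h1 : q ^ (n + K') ≤ q ^ N := pow_le_pow_of_le_one hq0 hq1.le hNK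
      have h2 : Cf * q ^ (n + K') ≤ (Cf + 1) * q ^ N :=
        calc Cf * q ^ (n + K') ≤ Cf * q ^ N := mul_le_mul_of_nonneg_left h1 hCf0
          _ ≤ Cf * q ^ N + q ^ N := le_add_of_nonneg_right (pow_nonneg hq0 N)
          _ = (Cf + 1) * q ^ N := by ring
      have h := (lt_div_iff₀ (by positivity : (0 : ℝ) < 2 * (Cf + 1))).1 hN
      have h3 : (Cf + 1) * q ^ N < L * D * η' / 2 := by
        have e : (Cf + 1) * q ^ N = (q ^ N * (2 * (Cf + 1))) / 2 := by ring
        rw [e]; exact div_lt_div_of_pos_right h two_pos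
      exact lt_of_le_of_lt h2 h3
    have hcont : ContinuousOn (S K') (Icc 0 t) := fun τ hτ =>
      ((hSder K' τ hτ).continuousWithinAt).mono Icc_subset_Ici_self
    have hderS : ∀ τ ∈ Ico (0 : ℝ) t, HasDerivWithinAt (S K')
        (f n τ - f ((n + K' : ℕ) : ℤ) τ - ∑ k ∈ Finset.range K', d k τ) (Ici τ) τ := fun τ hτ =>
      (hSder K' τ ⟨hτ.1, hτ.2.le⟩).mono (Ici_subset_Ici.2 hτ.1)
    have hcmp := image_le_of_deriv_right_lt_deriv_boundary hcont hderS
      (by rw [hS0]; positivity) (fun x => hasDerivAt_const x (L ^ 2)) (fun τ hτ heq => by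
        have hτ' : τ ∈ Icc (0 : ℝ) t := ⟨hτ.1, hτ.2.le⟩
        have hsq : Real.sqrt (S K' τ) = L := by rw [heq]; exact Real.sqrt_sq hL0.le
        have h1 := hfin K' hK'1 τ hτ'
        rw [hsq] at h1
        have h2 := (abs_le.1 (hfbound (n + K') τ hτ')).1
        have h3 := hdS K' τ
        rw [show S K' τ = L ^ 2 from heq] at h3
        have h4 : D * L = 2 * a + D * η' := by rw [hLdef]; field_simp
        have h5 : D * L ^ 2 = 2 * a * L + L * D * η' := by
          calc D * L ^ 2 = (D * L) * L := by ring
            _ = (2 * a + D * η') * L := by rw [h4]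
            _ = 2 * a * L + L * D * η' := by ring
        have h6 : 0 < L * D * η' := by positivity
        show f n τ - f ((n + K' : ℕ) : ℤ) τ - ∑ k ∈ Finset.range K', d k τ < 0
        linarith [h1, h2, h3, hflux, h5, h6])
    have hSt : S K' t ≤ L ^ 2 := hcmp (right_mem_Icc.2 ht0)
    have hjt : ‖shellVec X (j : ℤ) t‖ ^ 2 ≤ S K' t := by
      have hmem : j - (n + 1) ∈ Finset.range K' := Finset.mem_range.2 (by omega)
      have h1 := Finset.single_le_sum (f := fun k => ‖shellVec X ((n + 1 + k : ℕ) : ℤ) t‖ ^ 2)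
        (fun _ _ => by positivity) hmem
      have e : ((n + 1 + (j - (n + 1)) : ℕ) : ℤ) = (j : ℤ) := by push_cast; omega
      rw [e] at h1
      exact h1
    exact (pow_le_pow_iff_left₀ (norm_nonneg _) hL0.le two_ne_zero).1 (hjt.trans hSt)
  have hfinal : ‖shellVec X (j : ℤ) t‖ ≤ 2 * a / D := le_of_forall_pos_lt_add fun η hη => by
    have := hmain (η / 2) (by positivity); linarith
  refine hfinal.trans (le_of_eq ?_)
  rw [hadef, hDdef]
  field_simp

/-- **ONE QUIET SHELL ⇒ (4.5)-REGULAR.** A `ν̂`-viscous flow (`ν̂ > 0`, `α` cancelling, one-shell datum, no shells below `0`,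
(4.5)-regular before `T`) with ONE shell `n ≥ 0` (S₁)-quiet, `(1+ε₀)^n ‖x_n(t)‖² ≤ B²` on `[0,T)`, `0 ≤ B ≤ B₁ = ν̂/(2(C_A+1)(1+ε₀)^9)`,
has every shell `j ≥ n` quiet at the same level (tail bound + induction), hence bounded (4.5) norm on `[0,T)`.
[cite: Tao2016AveragedNS, §4 (4.3), Lemma 4.1 (4.5) and the viscous equation before Thm. 4.2; Cheskidov2008, §4 (analogy)] -/
theorem weight45_bounded_of_oneQuietShell {ε₀ visc T B : ℝ} (hε : 0 < ε₀) (hvisc : 0 < visc)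
    {α : Fin m → Fin m → Fin m → ℤ × ℤ × ℤ → ℝ} (hc : IsCancellingCoeff α)
    {X : Fin m → ℤ → ℝ → ℝ} {X₀ : Fin m → ℝ}
    (hC1 : ∀ i n, ContDiffOn ℝ 1 (X i n) (Set.Ico 0 T))
    (hinit : ∀ i n, X i n 0 = if n = 0 then X₀ i else 0)
    (hlow : ∀ i n t, n < 0 → X i n t = 0)
    (hmot : ∀ i n t, 0 ≤ t → t < T → derivWithin (X i n) (Set.Ici 0) t =
      quadTerm ε₀ α X i n t - visc * (1 + ε₀) ^ ((2 : ℝ) * n) * X i n t)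
    (hreg : ∀ T' : ℝ, 0 < T' → T' < T → ∃ M : ℝ, ∀ t : ℝ, 0 ≤ t → t ≤ T' →
      ∀ (i : Fin m) (n : ℤ), (1 + (1 + ε₀) ^ ((10 : ℝ) * n)) * |X i n t| ≤ M)
    (hB0 : 0 ≤ B) (hBsmall : B ≤ visc / (2 * (shiftConst α (0, 0, 1) + 1) * (1 + ε₀) ^ 9))
    {n : ℕ} (hquiet : ∀ t : ℝ, 0 ≤ t → t < T → (1 + ε₀) ^ n * ‖shellVec X (n : ℤ) t‖ ^ 2 ≤ B ^ 2) :
    ∃ M : ℝ, ∀ t : ℝ, 0 ≤ t → t < T → ∀ (i : Fin m) (k : ℤ),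
      (1 + (1 + ε₀) ^ ((10 : ℝ) * k)) * |X i k t| ≤ M := by
  rcases le_or_gt T 0 with hT | hT
  · exact ⟨0, fun t ht htT => absurd (lt_of_le_of_lt ht htT) (not_lt.2 hT)⟩
  have hb : (0 : ℝ) < 1 + ε₀ := by linarith
  have hb1 : (1 : ℝ) ≤ 1 + ε₀ := by linarith
  have hC0 : 0 ≤ shiftConst α (0, 0, 1) := shiftConst_nonneg α _
  have hCB : shiftConst α (0, 0, 1) * B ≤ visc := by
    have h := (le_div_iff₀ (by positivity)).1 hBsmall
    have h9 : (1 : ℝ) ≤ (1 + ε₀) ^ 9 := one_le_pow₀ hb1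
    nlinarith [mul_nonneg hC0 hB0, mul_le_mul_of_nonneg_left h9 (mul_nonneg hC0 hB0)]
  have hder : ∀ i k, ∀ τ ∈ Ico (0 : ℝ) T, HasDerivWithinAt (X i k)
      (quadTerm ε₀ α X i k τ - visc * (1 + ε₀) ^ ((2 : ℝ) * k) * X i k τ) (Ici 0) τ := by
    intro i k τ hτ
    have hd : DifferentiableWithinAt ℝ (X i k) (Ico 0 T) τ := ((hC1 i k).differentiableOn one_ne_zero) τ hτ
    have hd' : DifferentiableWithinAt ℝ (X i k) (Ici 0) τ := hd.mono_of_mem_nhdsWithin (by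
      rw [mem_nhdsWithin]; exact ⟨Iio T, isOpen_Iio, hτ.2, fun x hx => ⟨hx.2, hx.1⟩⟩)
    rw [← hmot i k τ hτ.1 hτ.2]
    exact hd'.hasDerivWithinAt
  have hreg' : ∀ T' : ℝ, T' < T → ∃ M : ℝ, ∀ τ ∈ Icc (0 : ℝ) T', ∀ (i : Fin m) (k : ℤ),
      (1 + (1 + ε₀) ^ ((10 : ℝ) * k)) * |X i k τ| ≤ M := fun T' hT' => by
    rcases le_or_gt T' 0 with h0 | h0
    · exact (hreg (T / 2) (by linarith) (by linarith)).imp fun M hM τ hτ i k => hM τ hτ.1 (by linarith [hτ.2]) i k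
    · exact (hreg T' h0 hT').imp fun M hM τ hτ i k => hM τ hτ.1 hτ.2 i k
  have hamp := viscous_abs_le_datumNorm hε hvisc.le hc hder hinit hlow hreg'
  have hD : ∀ (k : ℤ) (t : ℝ), 0 ≤ t → t < T → ‖shellVec X k t‖ ≤ Real.sqrt m * Real.sqrt (∑ j, X₀ j ^ 2) :=
    fun k t ht htT => DSSOneShift.norm_shellVec_le_sqrt_mul (Real.sqrt_nonneg _) (fun i => hamp t ⟨ht, htT⟩ i k)
  have hall : ∀ k : ℕ, ∀ t : ℝ, 0 ≤ t → t < T →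
      (1 + ε₀) ^ (n + k) * ‖shellVec X ((n + k : ℕ) : ℤ) t‖ ^ 2 ≤ B ^ 2 := by
    intro k; induction k with
    | zero => simpa using hquiet
    | succ k ih =>
      intro t ht htT
      set p : ℕ := n + k with hp
      have hPp : 0 < (1 + ε₀) ^ p := pow_pos hb p
      set sq : ℝ := B ^ 2 / (1 + ε₀) ^ p with hsq
      have hsq0 : 0 ≤ sq := by positivity
      have hs : ∀ τ : ℝ, 0 ≤ τ → τ < T → ‖shellVec X (p : ℤ) τ‖ ≤ Real.sqrt sq := fun τ hτ hτT => by
        refine Real.le_sqrt_of_sq_le ?_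
        rw [hsq, le_div_iff₀ hPp, mul_comm]
        exact ih τ hτ hτT
      have htail := tail_norm_le_of_shellBound hε hvisc hc hC1 hinit hmot hreg hs (p + 1) p.lt_succ_self t ht htT
      rw [Real.sq_sqrt hsq0] at htail
      show (1 + ε₀) ^ (p + 1) * ‖shellVec X ((p + 1 : ℕ) : ℤ) t‖ ^ 2 ≤ B ^ 2
      have hx0 : 0 ≤ ‖shellVec X ((p + 1 : ℕ) : ℤ) t‖ := norm_nonneg _
      have hx2 : ‖shellVec X ((p + 1 : ℕ) : ℤ) t‖ ^ 2 ≤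
          (bigLam ε₀ ^ p * shiftConst α (0, 0, 1) * sq / (visc * (1 + ε₀) ^ (2 * (p + 1)))) ^ 2 :=
        pow_le_pow_left₀ hx0 htail 2
      have hkey : (1 + ε₀) ^ (p + 1) *
          (bigLam ε₀ ^ p * shiftConst α (0, 0, 1) * sq / (visc * (1 + ε₀) ^ (2 * (p + 1)))) ^ 2 ≤ B ^ 2 := by
        have e : (1 + ε₀) ^ (p + 1) *
            (bigLam ε₀ ^ p * shiftConst α (0, 0, 1) * sq / (visc * (1 + ε₀) ^ (2 * (p + 1)))) ^ 2 =
            (shiftConst α (0, 0, 1) * B) ^ 2 * B ^ 2 / (visc ^ 2 * (1 + ε₀) ^ 3) := by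
          rw [div_pow, mul_pow, mul_pow, bigLam_pow_sq hε.le p, hsq]
          field_simp
          ring
        rw [e, div_le_iff₀ (by positivity)]
        have h1 : (shiftConst α (0, 0, 1) * B) ^ 2 ≤ visc ^ 2 := pow_le_pow_left₀ (mul_nonneg hC0 hB0) hCB 2
        have h2 : visc ^ 2 ≤ visc ^ 2 * (1 + ε₀) ^ 3 := le_mul_of_one_le_right (sq_nonneg _) (one_le_pow₀ hb1)
        have hB2 : 0 ≤ B ^ 2 := sq_nonneg B
        nlinarith [mul_le_mul_of_nonneg_right (h1.trans h2) hB2]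
      exact (mul_le_mul_of_nonneg_left hx2 (pow_pos hb _).le).trans hkey
  set ν : ℝ := (Real.sqrt (1 + ε₀))⁻¹ with hν_def
  have hsq1 : 0 < Real.sqrt (1 + ε₀) := Real.sqrt_pos.2 hb
  have hν : 0 < ν := inv_pos.2 hsq1
  have hνsq : ν ^ 2 = (1 + ε₀)⁻¹ := by rw [hν_def, inv_pow, Real.sq_sqrt hb.le]
  have hcrit : (1 + ε₀) * ν ^ 2 ≤ 1 := by rw [hνsq, mul_inv_cancel₀ hb.ne']
  have hceil : ∀ (j : ℤ) (t : ℝ), (n : ℤ) ≤ j → 0 ≤ t → t < T → ‖shellVec X j t‖ ≤ B * ν ^ j := by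
    intro j t hj ht htT
    obtain ⟨j', rfl⟩ := Int.eq_ofNat_of_zero_le ((Int.natCast_nonneg n).trans hj)
    obtain ⟨k, rfl⟩ := Nat.exists_eq_add_of_le (show n ≤ j' by exact_mod_cast hj)
    have h := hall k t ht htT
    have hpow : (B * ν ^ ((n + k : ℕ) : ℤ)) ^ 2 * (1 + ε₀) ^ (n + k) = B ^ 2 := by
      rw [zpow_natCast, mul_pow, ← pow_mul, mul_comm (n + k) 2, pow_mul, hνsq, inv_pow, mul_assoc,
        inv_mul_cancel₀ (pow_ne_zero _ hb.ne'), mul_one]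
    have hle : ‖shellVec X ((n + k : ℕ) : ℤ) t‖ ^ 2 ≤ (B * ν ^ ((n + k : ℕ) : ℤ)) ^ 2 := by
      nlinarith [hpow, h, pow_pos hb (n + k)]
    exact (pow_le_pow_iff_left₀ (norm_nonneg _) (by positivity) two_ne_zero).1 hle
  exact weight45_bounded_of_smallCriticalCeiling hε hvisc hc hC1 hinit hlow hmot hD hν hcrit hB0 hBsmall hceil

/-- **ROBUST BLOW-UP ⇒ EVERY SHELL OF EVERY VISCOUS COMPANION IS (S₁)-LOUD.** If `NoGlobalCascade ε₀ α X₀` (`ε₀ > 0`,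
`α ∈ E₂(R)`, any `m`), then for every viscosity `0 < ν̂ ≤ κ/√2` the maximal `ν̂`-viscous flow from the one-shell datum
(datum, no shells below `0`, viscous motion, (4.5)-regular before `T`, (4.5) norm unbounded) reaches, on EVERY shell
`n ≥ 0`, `(1+ε₀)^n ‖x_n(t)‖² > B₁²` at some `t ∈ [0,T)`, `B₁ = ν̂/(2(C_A+1)(1+ε₀)^9)` — clause (iv) of
`WakeRatchet.MinimalViscousBlowup` (⟨22743⟩) at every small viscosity.
[cite: Tao2016AveragedNS, §4 Thm. 4.2, the viscous equation before Thm. 4.2, Lemma 4.1 (4.5); Teschl2012, §2.6 Cor. 2.16] -/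
theorem everyShellLoud_of_noGlobalCascade {ε₀ R : ℝ} (hε : 0 < ε₀)
    {α : Fin m → Fin m → Fin m → ℤ × ℤ × ℤ → ℝ} {X₀ : Fin m → ℝ} (hα : InTableClass R α)
    (hNG : NoGlobalCascade ε₀ α X₀) :
    ∃ κ : ℝ, 0 < κ ∧ ∀ visc : ℝ, 0 < visc → visc * Real.sqrt 2 ≤ κ →
      ∃ (T : ℝ) (X : Fin m → ℤ → ℝ → ℝ), 0 < T ∧
        (∀ i n, ContDiffOn ℝ 1 (X i n) (Set.Ico 0 T)) ∧
        (∀ i n, X i n 0 = if n = 0 then X₀ i else 0) ∧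
        (∀ i n t, n < 0 → X i n t = 0) ∧
        (∀ i n t, 0 ≤ t → t < T → derivWithin (X i n) (Set.Ici 0) t =
          quadTerm ε₀ α X i n t - visc * (1 + ε₀) ^ ((2 : ℝ) * n) * X i n t) ∧
        (∀ T' : ℝ, 0 < T' → T' < T → ∃ M : ℝ, ∀ t : ℝ, 0 ≤ t → t ≤ T' →
          ∀ (i : Fin m) (n : ℤ), (1 + (1 + ε₀) ^ ((10 : ℝ) * n)) * |X i n t| ≤ M) ∧
        (∀ M : ℝ, ∃ t : ℝ, 0 ≤ t ∧ t < T ∧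
          ∃ (i : Fin m) (n : ℤ), M < (1 + (1 + ε₀) ^ ((10 : ℝ) * n)) * |X i n t|) ∧
        ∀ n : ℕ, ∃ t : ℝ, 0 ≤ t ∧ t < T ∧
          (visc / (2 * (shiftConst α (0, 0, 1) + 1) * (1 + ε₀) ^ 9)) ^ 2 <
            (1 + ε₀) ^ n * ‖shellVec X (n : ℤ) t‖ ^ 2 := by
  obtain ⟨κ, hκ, H⟩ := maximalViscousFlow_of_noGlobalCascade hε hα hNG
  refine ⟨κ, hκ, fun visc hvisc hvk => ?_⟩
  obtain ⟨T, X, hT, h1, h2, h3, h4, h5, h6⟩ := H visc hvisc.le hvk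
  refine ⟨T, X, hT, h1, h2, h3, h4, h5, h6, fun n => ?_⟩
  have hC0 : 0 ≤ shiftConst α (0, 0, 1) := shiftConst_nonneg α _
  have hb : (0 : ℝ) < 1 + ε₀ := by linarith
  have hB₁ : 0 < visc / (2 * (shiftConst α (0, 0, 1) + 1) * (1 + ε₀) ^ 9) := by positivity
  by_contra hcon
  push Not at hcon
  obtain ⟨M, hM⟩ := weight45_bounded_of_oneQuietShell hε hvisc hα.2.1 h1 h2 h3 h4 h5 hB₁.le le_rfl hcon
  obtain ⟨t, ht0, htT, i, k, hlt⟩ := h6 M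
  exact absurd (hM t ht0 htT i k) (not_le.2 hlt)

end BlowupRigidityOne

end Summit.NavierStokesRegularity.NavierStokesRegularity.Theorems

end
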